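import Summits.BirchSwinnertonDyer.BirchSwinnertonDyer.Theorems.ClassRecordThreeEulerHalvesAtThreeCartanCoverDockedLineSaturation
import Literature.NumberTheory.Automorphic.QuaternionOrderResidueStrongApproximation
import HarnessLib

/-!
# (M0) `StrongApproxAtCartanPlace` is a THEOREM — crux `CartanOnePlaceDegreeLawAtThree` (NUM, stmt-BirchSwinnertonDyer-24801), lines `lattice` v6 ∕ `charext`

The print input (M0) `CartanCover.Charext.StrongApproxAtCartanPlace` of `…CartanCoverDockedLineSaturation` (p738423; «the reduction
`redHom : ι(O₀'¹) → GL₂(𝔽_q)` of a `CoverReduction` is ONTO `SL₂(𝔽_q)`») is DISCHARGED from the Literature theorem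
`Literature.NumberTheory.Automorphic.exists_reducedNorm_eq_one_map_eq_of_det_eq_one` (`QuaternionOrderResidueStrongApproximation.lean`, bsd-stepL
defn-ty1 g42 — TYPED AND PROVED by that seat, landed verbatim under this file name by the crux LEAD tam3-p1 g27 because the seat's target name
`…CartanCoverStrongApprox` was taken minutes earlier by the lead's odd-place version `CoverReduction.redHom_surjective_of_odd` (p739028): Eichler–Kneser strong approximation in residue form for ANY order of an indefinite quaternion algebra over `ℚ` at a prime `q`, through a
residue map with exactly the fields `red_surjective` ∕ `red_eq_zero_iff` ∕ `det_red` of `CartanCover.CoverReduction`; `q = 2` included). The hypothesis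
`q ∈ C` of (M0) is not used. Consequence: `saturationAtThree_of_leaves hM strongApproxAtCartanPlace_holds hOBS : CartanCover.SaturationAtThree` — the cite
stub of `Lines/lattice` v6 loses its (M0) conjunct. Nothing is asserted about any curve; BSD is proved for no curve.
[cite: VignerasLNM800, Ch. III §4 Thm. 4.3 and §5] [cite: Voight2021, Thm. 28.5.3 and Cor. 28.5.4]
-/

set_option linter.dupNamespace false
set_option autoImplicit false

noncomputable section

namespace Summit.BirchSwinnertonDyer.BirchSwinnertonDyer.Theorems.CartanCover.Charext

open Summit.BirchSwinnertonDyer.BirchSwinnertonDyer.Theorems Literature.NumberTheory.Automorphic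

/-- **(M0) PROVED: `redHom : ι(O₀'¹) → GL₂(𝔽_q)` is onto `SL₂(𝔽_q)`** for every Cartan datum `X`, every place `q` and every reduction datum
`R : CoverReduction X q` (Eichler–Kneser strong approximation for the norm-one group of the cover order `O₀'`, residue form; Literature
`exists_reducedNorm_eq_one_map_eq_of_det_eq_one` + `exists_mem_normOneUnits_coe_eq`). [cite: VignerasLNM800, Ch. III §4 Thm. 4.3 and §5] -/
theorem strongApproxAtCartanPlace_holds : StrongApproxAtCartanPlace := by
  intro D M C X q _ _ R g hg
  obtain ⟨u, hnu, hred⟩ := exists_reducedNorm_eq_one_map_eq_of_det_eq_one X.ι (CartanCover.isOrder_coverOrder X q)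
    (CartanCover.coverSubring X q) (fun x => CartanCover.mem_coverSubring_iff X q) R.red R.red_surjective
    R.red_eq_zero_iff R.det_red (g : Matrix (Fin 2) (Fin 2) (ZMod q)) hg
  obtain ⟨γ, hγ, hγu⟩ := exists_mem_normOneUnits_coe_eq X.ι (CartanCover.isOrder_coverOrder X q) u.2 hnu
  refine ⟨⟨γ, hγ⟩, Units.ext ?_⟩
  rw [CartanCover.CoverReduction.coe_redHom, CartanCover.unitLift_eq_of_ι_eq ⟨γ, hγ⟩ u.2 hγu.symm]
  exact hred

end Summit.BirchSwinnertonDyer.BirchSwinnertonDyer.Theorems.CartanCover.Charext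

end
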